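import Literature.NumberTheory.Automorphic.BianchiCuspidalEigenclassOfResGLn
import Literature.NumberTheory.Automorphic.ResGLnCuspidalEigenclassOfClean
import HarnessLib

/-!
# `bianchi_cuspidal_regularLAlgebraic_eigenclassExists`: it suffices to realise CLEAN cuspidal
# data of `GL₂` over imaginary quadratic fields (the Gelfand–Piatetski-Shapiro step, Bianchi slice)

Topic `NumberTheory/Automorphic`; namespace `Literature.NumberTheory.Automorphic`.  Theorems only:
no definition, no named fact, no `sorry` (D-0026).  Filed in support of the named fact
`bianchi_cuspidal_regularLAlgebraic_eigenclassExists` (`BianchiCuspidalEigenclass`; Eichler–Shimura–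
Harder existence for `GL₂` over an imaginary quadratic field).

The tree reduces that fact to its BIANCHI SLICE of the cuspidal-eigenclass statement
(`bianchi_cuspidal_regularLAlgebraic_eigenclassExists_of_resGLTwo`, hypothesis `h2`: for `K`
totally complex of degree `2`, `𝔫 ≠ 0`, dominant `λ`, EVERY cuspidal datum `π = W / W'` of
Borel–Jacquet with cohomological `a`-exponents of the dual weights and a `K(𝔫)`-fixed
`φ ∈ W ∖ W'` has a non-zero simultaneous `T_{v,i}`-eigenclass in
`ResGLnCohomology.levelCohomology ℂ 2 K 𝔫 λ q` with the Satake–Tamagawa eigenvalues), and it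
reduces the general-`n` fact `ResGLnCohomology.cuspidalEigenclass_exists` to CLEAN cuspidal data
(`W' = ⊥`, `1 ∈ 𝔤` acting on `W` by a scalar, so `A_G` by a quasi-character) by the theorem of
Gelfand–Piatetski-Shapiro / Langlands in the tree's form
`CuspidalAutomorphicRepData.exists_isShiftRealisation_of_sSup_irreducible`
(`ResGLnCohomology.cuspidalEigenclass_exists_of_clean`).  THIS FILE is the pointwise (`n = 2`,
`K` imaginary quadratic) form of the latter, feeding the former:

* `bianchi_cuspidal_regularLAlgebraic_eigenclassExists_of_cleanResGLTwo` — **the Bianchi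
  Eichler–Shimura–Harder fact follows from the realisation of CLEAN cuspidal data of `GL₂` over
  imaginary quadratic fields**: hypothesis `h2c` = `h2` restricted to `π = C / ⊥` with `1 ∈ 𝔤`
  acting on `C` by a scalar `μ` (and the fixed vector stated as `φ ≠ 0`), which is the setting in
  which the degree-one Eichler–Shimura–Harder class is constructed (lowest `U(2)`-type of the
  `(𝔤, K_∞)`-module `C`, Petersson form on `C ⊗ |det|^s`, [cite: Harder1987, §3.1]).  Proof, as in
  `cuspidalEigenclass_exists_of_clean`: realise `π` by a clean `π₀ = C / ⊥` along `N = (1 - μ)^j`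
  (`exists_isShiftRealisation_of_sSup_irreducible` over the discharged semisimplicity fact
  `AutomorphicRepsGL.stable_cuspidal_eq_sSup_irreducible_holds`), move the infinity type
  (`IsShiftRealisation.hasInfinityType`) and the `K(𝔫)`-fixed vector
  (`IsShiftRealisation.exists_fixed_ne_zero`) to `π₀`, take the eigenclass of `π₀`, and identify
  the Satake parameters at `v ∤ 𝔫`: `π₀` is unramified there (`hasSatakeParamAt_of_fixed`, Flath),
  its parameter is one of `π` (`IsShiftRealisation.hasSatakeParamAt`) and Satake parameters of `π`
  are unique (`hasSatakeParamAt_unique_holds`)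
  [cite: BorelJacquetCorvallis1979, §4.6 and 5.7] [cite: Clozel1990, §3.5 (p. 123)];
* `bianchi_cuspidal_regularLAlgebraic_eigenclassExists_of_cleanResGLTwo'` — the same with the
  scalar hypothesis in the `A_G`-form used by the Petersson-form files: some `μ` with
  `lieDeriv 1 c = μ • c` on `C` is all that is asked (identical statement, the primed name only
  unbundles `∃ T` / `∃ φ` into separate hypotheses for convenient application).

So the discharge `bianchi_cuspidal_regularLAlgebraic_eigenclassExists_holds` is ONE application of
either theorem to the degree-one Eichler–Shimura–Harder realisation of clean cohomological cuspidal
`π` on `GL₂` over imaginary quadratic `K`.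

## References

* A. Borel, H. Jacquet, *Automorphic forms and automorphic representations*, Proc. Sympos. Pure
  Math. 33 (Corvallis 1977), part 1 (1979), §4.6 and 5.7 [BorelJacquetCorvallis1979].
* G. Harder, *Eisenstein cohomology of arithmetic groups. The case GL₂*, Invent. Math. 89 (1987),
  §3.1 [Harder1987].
* L. Clozel, *Motifs et formes automorphes* (1990), §3.5 (p. 123), Lemme 3.14–3.15 [Clozel1990].
* D. Flath, *Decomposition of representations into tensor products*, Corvallis (1979), Thm. 3
  [FlathCorvallis1979].
* P. Scholze, Ann. of Math. 182 (2015), §V.4, proof of Cor. V.4.2 [Scholze2015].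
-/

noncomputable section

open scoped MatrixGroups Classical
open NumberField IsDedekindDomain
open Literature.NumberTheory.DiophantineGeometry Literature.Barriers.Langlands

namespace Literature.NumberTheory.Automorphic

/-- A uniformiser of valuation `exp (-1)` at `v` (Mathlib `valuation_exists_uniformizer`), read in
the completion. [folklore] -/
private theorem valued_uniformizer_bianchiClean {K : Type} [Field K] [NumberField K]
    (v : HeightOneSpectrum (𝓞 K)) :
    Valued.v ((Classical.choose (v.valuation_exists_uniformizer K) : K) : v.adicCompletion K) =
      WithZero.exp (-1 : ℤ) := by
  rw [HeightOneSpectrum.valuedAdicCompletion_eq_valuation']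
  exact Classical.choose_spec (v.valuation_exists_uniformizer K)

/-- The uniformiser of `valued_uniformizer_bianchiClean` is non-zero in the completion, hence a
unit. [folklore] -/
private theorem uniformizer_ne_zero_bianchiClean {K : Type} [Field K] [NumberField K]
    (v : HeightOneSpectrum (𝓞 K)) :
    ((Classical.choose (v.valuation_exists_uniformizer K) : K) : v.adicCompletion K) ≠ 0 := by
  intro h
  have := valued_uniformizer_bianchiClean v
  rw [h, map_zero] at this
  exact WithZero.zero_ne_coe this

/-- **`bianchi_cuspidal_regularLAlgebraic_eigenclassExists` from the realisation of CLEAN cuspidal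
data of `GL₂` over imaginary quadratic fields** (the Gelfand–Piatetski-Shapiro step, Bianchi
slice).  If for every imaginary quadratic `K`, `𝔫 ≠ 0`, dominant weights `λ_τ` and every cuspidal
datum `π = C / ⊥` of `GL₂(𝔸_K)` with `W' = ⊥`, on which `1 ∈ 𝔤` acts by a scalar, whose infinity
type has the cohomological `a`-exponents of the dual weights `λ_τ^∨` and which has a non-zero
`K(𝔫)`-fixed form, some `H^q(GL₂(K)⁺, Fun(GL₂(𝔸_K^∞)/K_f(𝔫), E_λ(ℂ)))` contains a non-zero
simultaneous eigenclass of the `T_{v,i}`, `v ∤ 𝔫`, with the eigenvalues `q_v^{i(2−i)/2} e_i(α_v)`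
— the degree-one Eichler–Shimura–Harder realisation [cite: Harder1987, §3.1] — then the named fact
holds: an arbitrary cuspidal `π = W / W'` is realised by such a clean `π₀`
(`exists_isShiftRealisation_of_sSup_irreducible`, [cite: BorelJacquetCorvallis1979, §4.6 and 5.7]),
with the same infinity type, a non-zero `K(𝔫)`-fixed vector and the same Satake parameters
(`IsShiftRealisation.hasInfinityType / exists_fixed_ne_zero / hasSatakeParamAt`, Flath's
`hasSatakeParamAt_of_fixed`, uniqueness `hasSatakeParamAt_unique_holds`), and
`bianchi_cuspidal_regularLAlgebraic_eigenclassExists_of_resGLTwo` does the rest.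
[cite: Clozel1990, §3.5 (p. 123)] [cite: Scholze2015, §V.4, proof of Cor. V.4.2] -/
theorem bianchi_cuspidal_regularLAlgebraic_eigenclassExists_of_cleanResGLTwo
    (h2c : ∀ (K : Type) [Field K] [NumberField K], NumberField.IsTotallyComplex K →
      Module.finrank ℚ K = 2 → ∀ (hcpt : isCompact_glFiniteIntegralLevel 2 K)
      (𝔫 : Ideal (𝓞 K)) (lam : (K →+* ℂ) → Fin 2 → ℤ), 𝔫 ≠ 0 →
      (∀ τ, Weight.IsDominant (lam τ)) →
      ∀ π : CuspidalAutomorphicRepData 2 K hcpt, π.1.W' = ⊥ →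
        (∃ μ : ℂ, ∀ c ∈ π.1.W, lieDeriv (AutomorphyDatum.gl 2 K hcpt).ofArch
          (⟨1, trivial⟩ : (AutomorphyDatum.gl 2 K hcpt).arch.lie) c = μ • c) →
        (∃ T : InfinityType K 2, π.1.HasInfinityType T ∧
          ∀ τ : K →+* ℂ, (T τ).map ArchWeight.a =
            (cohomologicalInfinityType 2 K (Weight.dual (lam τ)) τ).map ArchWeight.a) →
        (∃ φ ∈ π.1.W, φ ≠ 0 ∧
          ∀ u ∈ principalCongruenceLevel 2 K 𝔫, rightTranslation (AdelicGroupData.gl 2 K) u φ = φ) →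
        ∃ (q : ℕ) (x : ResGLnCohomology.levelCohomology ℂ 2 K 𝔫 lam q), x ≠ 0 ∧
          ∀ v : HeightOneSpectrum (𝓞 K), ¬ v.asIdeal ∣ 𝔫 → ∀ α : Multiset ℂ,
            π.1.HasSatakeParamAt v α → ∀ i ≤ 2,
              ResGLnCohomology.heckeT ℂ 2 K 𝔫 lam q v i x = heckeEigenvalueOf 2 v α i • x) :
    bianchi_cuspidal_regularLAlgebraic_eigenclassExists := by
  refine bianchi_cuspidal_regularLAlgebraic_eigenclassExists_of_resGLTwo ?_
  intro K _ _ htc hdeg hcpt 𝔫 lam h𝔫 hlam π hT hφ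
  -- realise `π` by a clean `π₀ = C / ⊥` along `N = (1 - μ)^j`
  obtain ⟨π₀, μ, j, M, hsr⟩ :=
    π.exists_isShiftRealisation_of_sSup_irreducible
      AutomorphicRepsGL.stable_cuspidal_eq_sSup_irreducible_holds
  obtain ⟨φ, hφW, hφW', hfix⟩ := hφ
  obtain ⟨c, hcW, hc0, hcfix⟩ := hsr.exists_fixed_ne_zero h𝔫 hφW hφW' hfix
  obtain ⟨T, hT, hTa⟩ := hT
  obtain ⟨q, x, hx, heig⟩ := h2c K htc hdeg hcpt 𝔫 lam h𝔫 hlam π₀ hsr.bot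
    ⟨μ, fun c hc => hsr.lieDeriv_one_eq_smul hc⟩ ⟨T, hsr.hasInfinityType hT, hTa⟩
    ⟨c, hcW, hc0, hcfix⟩
  refine ⟨q, x, hx, fun v hv α hα i hi => ?_⟩
  -- `π₀` is unramified at `v ∤ 𝔫`, with the Satake parameter of `π`
  have hcW' : c ∉ π₀.1.W' := fun hmem => hc0 (by
    rw [hsr.bot] at hmem
    exact (Submodule.mem_bot ℂ).1 hmem)
  obtain ⟨α₀, hα₀⟩ := AutomorphicRepData.hasSatakeParamAt_of_fixed
    π₀.1.Flath1979_heckeOperator_ofLocal_sub_smul_mem_holds h𝔫 hv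
    (ϖ := Units.mk0 _ (uniformizer_ne_zero_bianchiClean v)) (valued_uniformizer_bianchiClean v)
    hcW hcW' hcfix
  have hαeq : α = α₀ := π.1.hasSatakeParamAt_unique_holds hα (hsr.hasSatakeParamAt hα₀)
  subst hαeq
  exact heig v hv α hα₀ i hi

/-- **The same, hypotheses unbundled** (one clean `π`, its scalar `μ`, an infinity type `T` with
the cohomological `a`-exponents, one non-zero `K(𝔫)`-fixed `φ` as separate arguments), for direct
application to a realisation theorem stated argument by argument. [cite: Harder1987, §3.1]
[cite: BorelJacquetCorvallis1979, §4.6 and 5.7] [cite: Clozel1990, §3.5 (p. 123)] -/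
theorem bianchi_cuspidal_regularLAlgebraic_eigenclassExists_of_cleanResGLTwo'
    (h2c : ∀ (K : Type) [Field K] [NumberField K], NumberField.IsTotallyComplex K →
      Module.finrank ℚ K = 2 → ∀ (hcpt : isCompact_glFiniteIntegralLevel 2 K)
      (𝔫 : Ideal (𝓞 K)) (lam : (K →+* ℂ) → Fin 2 → ℤ), 𝔫 ≠ 0 →
      (∀ τ, Weight.IsDominant (lam τ)) →
      ∀ (π : CuspidalAutomorphicRepData 2 K hcpt), π.1.W' = ⊥ →
      ∀ (μ : ℂ), (∀ c ∈ π.1.W, lieDeriv (AutomorphyDatum.gl 2 K hcpt).ofArch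
          (⟨1, trivial⟩ : (AutomorphyDatum.gl 2 K hcpt).arch.lie) c = μ • c) →
      ∀ (T : InfinityType K 2), π.1.HasInfinityType T →
        (∀ τ : K →+* ℂ, (T τ).map ArchWeight.a =
            (cohomologicalInfinityType 2 K (Weight.dual (lam τ)) τ).map ArchWeight.a) →
      ∀ φ ∈ π.1.W, φ ≠ 0 →
        (∀ u ∈ principalCongruenceLevel 2 K 𝔫, rightTranslation (AdelicGroupData.gl 2 K) u φ = φ) →
        ∃ (q : ℕ) (x : ResGLnCohomology.levelCohomology ℂ 2 K 𝔫 lam q), x ≠ 0 ∧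
          ∀ v : HeightOneSpectrum (𝓞 K), ¬ v.asIdeal ∣ 𝔫 → ∀ α : Multiset ℂ,
            π.1.HasSatakeParamAt v α → ∀ i ≤ 2,
              ResGLnCohomology.heckeT ℂ 2 K 𝔫 lam q v i x = heckeEigenvalueOf 2 v α i • x) :
    bianchi_cuspidal_regularLAlgebraic_eigenclassExists := by
  refine bianchi_cuspidal_regularLAlgebraic_eigenclassExists_of_cleanResGLTwo ?_
  intro K _ _ htc hdeg hcpt 𝔫 lam h𝔫 hlam π hbot hμ hT hφ
  obtain ⟨μ, hμ⟩ := hμ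
  obtain ⟨T, hT, hTa⟩ := hT
  obtain ⟨φ, hφW, hφ0, hfix⟩ := hφ
  exact h2c K htc hdeg hcpt 𝔫 lam h𝔫 hlam π hbot μ hμ T hT hTa φ hφW hφ0 hfix

end Literature.NumberTheory.Automorphic

end
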